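import Summits.HodgeConjecture.HodgeConjecture.Theorems.H413ThetaDistAtLineArchRows
import Summits.HodgeConjecture.HodgeConjecture.Theorems.H413ArchTypeRigidity
import HarnessLib

/-!
# FLOOR-0 P4, S4b — the archimedean TYPE rows of the slot-`0` character FROM THE CENTRE IDENTITY (CC₀)
# (converse of ★ `HodgeCM/Model/ArchKTypeOfCentralWeightPin`: rows ⇐ (CF₀) ⇐ (CC₀); sequel of ★ `Theorems/H413ThetaDistAtLineArchRows`)

Cell hodgecm-mathlib (D-0151), FLOOR 0, crux item H413 = stmt-HodgeConjecture-24833; programme P4, line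
`Cruxes/H413/Lines/F0_P4AdmissibleOccursInH1.lean` (ED. 2.1), stub S4b `stub_T3a_holThetaAtAdmissibleLineOfRallisAt` (lead F0P4-p01).  Author F0P4-p04
(g2).  `--supports stmt-HodgeConjecture-24833 --as helper`.  KERNEL ONLY: theorems over LANDED model-layer theorems; nothing is cited as a fact, no
`sorry`, no definition.

WHY.  ★ `Theorems/H413ThetaDistAtLineArchRows` (p04 (g0)) reduces the archimedean inputs `harm` ∕ `hdef` of ★ `ThetaDistAtLine.distDatumAt` at a general
weight-one `μ` to two archimedean-TYPE rows of the slot-`0` character: the `v₁`-row `hχ₀` (`hηm hm hm'`) and the definite row `hdefT`.  All four slot-`0`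
scalars of the model are ONE character `Ξ := lineCharV_zero … η₀` of `U(V)(𝔸)` (★ `ArchKTypeOfCentralWeight_1`: `lineScalar_zero_eq_lineCharV`,
`archScalar_zeroG_eq_lineCharV`, rfl), and at a general `μ` the junction forces `Ξ` to be the `V`-part of the GLOBAL central twist `s_μ = s₀ · ĉ` between
the `μ`-splitting and the model's chosen splitting `s₀ = splittingOf hGR₀` — an automorphic continuous character whose archimedean type is a THEOREM, not
a knob.  This file proves that both type rows FOLLOW from ONE scalar identity on the archimedean CENTRE, carch's

  (CC₀)  `∀ t, Ξ((t · 1_V)^𝔸) · lineC V a hGR₀ t = 1`   (`lineC` = ★ (F1) `ArchLineDatumOf`'s centre eigen-character of the pinned harmonic vector `linePhi`),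

i.e. from the CENTRAL TYPE of the twisted slot (★ `LiuIndex.centralTypeOfTwist_bigCharOfV_of_CC`: (CC₀) ⟺ central type `−𝟙_{w(ι₁)}`), by the det-rigidity and
centre tools of ★ `Theorems/H413ArchTypeRigidity`: (CC₀) and the centre eigen-equation ★ `cmArchWeilRep_center_linePhi` say that the TWISTED centre FIXES
`linePhi ≠ 0` ((CF₀)); at the centre concentrated at a definite `w(b)` this compares `Ξ = det^k` with the exponent table of record (★ `defExponentZero_spec`,
`det(ζ·1₃)^{a₀ b} = ζ^{3 a₀ b}`), at `w(ι₁)` it compares `Ξ ∘ s = (det A · d)^k` with the section formula (★ `smulPull_blockFamilyOfAt_stabilizer` + (K) ★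
`cmBlockRepAt_κ_tensorPi_lineVacExponentsZero` at the central `ζ · 1 ∈ K`: scalar `ζ^{2 e_P + e_Q + 1}`); `ζ^{3(k + a₀ b)} = 1` resp. `ζ^{3k + 2e_P + e_Q + 1} = 1`
on the whole circle pin `k`:

* §3 (CF₀) from (CC₀): `smul_cmArchWeilRep_center_linePhi_of_CC`;
* §4 **`hdefT_of_CC`** — the definite row `Ξ((archSingle (w b) u)^𝔸) · det(u)^{a₀ b} = 1`, `b ≠ v₁`;
* §5 `smul_cmArchWeilRep_section_centralK_linePhi` and **`hχ_zero_of_CC`** — the `v₁`-row `Ξ((s u)^𝔸) · detA(u)^{e_P} · d(u)^{e_Q} = d̄(u)` on `Stab(x₀)`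
  (`e_P − e_Q = 1`, ★ `lineVacExponentsZero_eP_sub_eQ`);
* §6 at the diagonal context `cDiag a` of ★ `Theorems/H413ThetaDistAtLine`, in the currency of ★ `H413ThetaDistAtLineArchRows` and of F0P4-p01's reduction theorem
  ★ `Theorems/H413HolThetaAtLineOfInputs` (`harm`, `hdef`): `continuous_lineCharV_zero_etaT₀` (from `hηc`, `hνc`, sign facts), **`harm_cDiag_of_CC`**,
  **`hdef_cDiag_of_CC`** — the `harm` ∕ `hdef` inputs of `distDatumAt` for ANY knob `(η, ν)` whose slot-`0` character satisfies (CC₀) against `lineC V a hGR₀`.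

What is NOT here: (CC₀) itself for the knob of junction J — it is «the `μ`-splitting has central type `−𝟙_{w(ι₁)}` on the Gaussian at the admissible line»
(★ `LiuIndex.hasCentralTypeAt_twistBy_ofCMOf_iff_eq` ∕ `centralTypeOfTwist_bigCharOfV_of_CC` + Liu side ★ `Liu2021/Def411WeilCarriersCentralTypeGaussian`
`pairRep_chiSplittingLine_toHeckeCharacter_center_gaussianV_tmul_cm`, type `centralType (weightOneType Φ_μ)` = `−𝟙_{w(ι₁)}` exactly under admissibility),
to be supplied in F0P4-p01's spelling of the twist (F0/P4/CENSUS-S4b-archRows-generalMu.v2).  HC_CM is proved only modulo the printed citations until rung 0 closes.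

## References
* Tree (all ★): `Theorems/H413ArchTypeRigidity` (§0–§2 tools), `HodgeCM/Model/ArchKTypeOfCentralWeight_1/_2` (`lineCharV_zero`, `centralK`, `coe_blockU_centralK`,
  `archToAdelic_cmArchCenter_frameD`), `HodgeCM/Model/ArchLineDatumOf_2` (`lineC`, `linePhi`, `linePhi_ne_zero`, `cmArchWeilRep_center_linePhi`),
  `HodgeCM/Model/ArchKTypeOfSlot` (`smulPull_blockFamilyOfAt_stabilizer`, `hsec_of_embedding_eq`, `unitaryOpPi_dualPairι_degOnePDual`), `HodgeCM/Model/ArchKTypeOfSlotRec_1`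
  (`lineVacExponentsZero`, `cmBlockRepAt_κ_tensorPi_lineVacExponentsZero`), `HodgeCM/Model/ArchKTypeOfLineTables` (`defExponentZero_spec`), `HodgeCM/Model/ArchKTypeOfDist`
  (`harm_lineOmega_zeroG`, `harch_zero_of_defType_tmulG`), `HodgeCM/Model/ArchSideOfTwist` (`continuous_etaT₀`), ★ `Theorems/H413ThetaDistAtLine` (`cDiag`, `compat_*`, `h₁W_cDiag`).
* [Liu2021] Y. Liu, Camb. J. Math. 9 (2021) = arXiv:2102.11518, App. D Lem. D.2 (1)(2), proof of Prop. 4.13 (l. 2145).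
  [KonnoKonno2007] T. Konno, K. Konno, Kyushu J. Math. 61 (2007), Lemma 5.2, Thm. 5.4.  [Folland1989] G. B. Folland, *Harmonic Analysis in Phase Space*, Prop. (4.39).
  [GelbartRogawski1991] S. Gelbart, J. Rogawski, Invent. Math. 105 (1991), §3.1 Prop. 3.1.1, Remark p. 457 L4–13.
-/

set_option autoImplicit false
set_option linter.dupNamespace false

noncomputable section

open NumberField hiding relNormOneIdeles relNormOneRat probHaarRelNormOneQuot
open _root_.NumberField.InfinitePlace _root_.NumberField.mixedEmbedding MeasureTheory MulAction IsDedekindDomain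
open scoped Matrix TensorProduct Classical SchwartzMap
open Literature.Geometry.ComplexHyperbolic.BallModel (U21 x₀ stabilizerEquivK21 blockK blockU mat coe_blockK stabilizerEquivK21_apply)
open Literature.NumberTheory.Automorphic.U21 (K21 matA sclD)
open Literature.NumberTheory.Automorphic Literature.NumberTheory.Automorphic.UnitaryGroup Literature.NumberTheory.Weil1964
open Literature.NumberTheory.GelbartRogawski1991 Literature.NumberTheory.GelbartRogawski1991.UnitaryDualPair
open Literature.AlgebraicGeometry.HodgeTheory Literature.AlgebraicGeometry.ShimuraVarieties Literature.AlgebraicGeometry.ShimuraVarieties.BallForms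
open Literature.AlgebraicGeometry.Motives (CMType)
open Literature.RepresentationTheory.KonnoKonno2007 Literature.RepresentationTheory.KonnoKonno2007.RealDualPair
open Literature.Analysis.SegalBargmann
open HodgeCM HodgeCM.Adelic HodgeCM.PerL34 HodgeCM.Model HodgeCM.Model.HypCensus HodgeCM.Model.ArchSideTerm HodgeCM.Model.ThetaDistFin
open HodgeCM.Model.ThetaAdelicSide HodgeCM.Model.SupplyInstance

namespace Summit.HodgeConjecture.HodgeConjecture.Cruxes.H413.ThetaDistAtLine

/-! ## §3 (CF₀) from (CC₀): the twisted archimedean centre fixes the pinned harmonic vector -/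

section Rows

variable {L : CMField} {ι₁ : L →+* ℂ} (V : HermSpace3 L ι₁) (c : SeesawCtx L)
variable
  (hGR : (cmSplittingDatum (L : Type) finProdFinEquiv (frameD V) (frameD_real V) (frameD_ne V) (dW c.D) (dW_real c.D) (dW_ne c.D)).CompatibleSplitting)
  (hGR₀ : (cmSplittingDatum (L : Type) (e₁) (frameD V) (frameD_real V) (frameD_ne V) (lineVec (L : Type) (dW c.D 0))
    (fun _ => dW_real c.D 0) (fun _ => dW_ne c.D 0)).CompatibleSplitting)
  (hGR₁ : (cmSplittingDatum (L : Type) (e₁) (frameD V) (frameD_real V) (frameD_ne V) (lineVec (L : Type) (dW c.D 1))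
    (fun _ => dW_real c.D 1) (fun _ => dW_ne c.D 1)).CompatibleSplitting)
  (h₁W : (∀ j, 0 < (ι₁ (dW c.D j)).re) ∨ ∀ j, (ι₁ (dW c.D j)).re < 0)
  (hpos : 0 < cmXW (L : Type) (frameD V) (lineVec (L : Type) (dW c.D 0)) (fun _ => dW_real c.D 0) ι₁ (HypCensus.cmPlace (L : Type) ι₁) 0)
  (hemb : (InfinitePlace.mk ι₁).embedding = ι₁)
variable (Ξ : CMAdelic (L : Type) (frameD V) →* ℂˣ) (hΞc : Continuous fun v => ((Ξ v : ℂˣ) : ℂ))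
  -- (CC₀): carch's centre identity for the slot-`0` character `Ξ` (the scalar form of (CF₀); for `Ξ := lineCharV_zero … η₀` it is the hypothesis `hCC`
  -- of ★ `LiuIndex.centralTypeOfTwist_bigCharOfV_of_CC`, i.e. «the twisted slot has central type `−𝟙_{w(ι₁)}`»)
  (hCC : ∀ t : ↥(Literature.NumberTheory.Automorphic.relNormOneInfUnits (↥(maximalRealSubfield L)) L),
    ((Ξ (CMCenter (L : Type) (frameD V) (infUnitToOne (L : Type) t)) : ℂˣ) : ℂ) * lineC V (dW c.D 0) (dW_real c.D 0) (dW_ne c.D 0) hGR₀ t = 1)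

include hCC in
/-- **(CF₀) from (CC₀)**: the archimedean centre `t · 1₃`, twisted by `Ξ`, FIXES the pinned harmonic vector `linePhi` of line `0` (★ `cmArchWeilRep_center_linePhi`:
the untwisted centre acts on it by `lineC t`). -/
theorem smul_cmArchWeilRep_center_linePhi_of_CC (t : ↥(Literature.NumberTheory.Automorphic.relNormOneInfUnits (↥(maximalRealSubfield L)) L)) :
    ((Ξ (UnitaryGroup.archToAdelic (↥(maximalRealSubfield L)) L (IsCMField.complexConj L) 3 (Matrix.diagonal (frameD V))
        (cmArchCenter (L : Type) 3 (Matrix.diagonal (frameD V)) t)) : ℂˣ) : ℂ) •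
      cmArchWeilRep (L : Type) e₁ (frameD V) (frameD_real V) (frameD_ne V) (lineVec (L : Type) (dW c.D 0)) (fun _ => dW_real c.D 0)
        (fun _ => dW_ne c.D 0) hGR₀ (cmArchCenter (L : Type) 3 (Matrix.diagonal (frameD V)) t, 1) (linePhi V (dW c.D 0) (dW_real c.D 0) (dW_ne c.D 0) hpos) =
      linePhi V (dW c.D 0) (dW_real c.D 0) (dW_ne c.D 0) hpos := by
  rw [cmArchWeilRep_center_linePhi, smul_smul, archToAdelic_cmArchCenter_frameD]
  have h := hCC t
  rw [infUnitToOne_apply] at h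
  rw [h, one_smul]

/-! ## §4 The definite row from (CC₀) -/

include hΞc hCC in
/-- **THE DEFINITE ROW `hdefT` FROM (CC₀).**  At every real place `b ≠ v₁` the slot-`0` character `Ξ` has type `−a₀(b)` against the exponent table of record
`a₀ := defExponentZero`: `Ξ((archSingle (w b) u)^𝔸) · det(u)^{a₀ b} = 1` — the hypothesis `hdefT` of ★ `hdef_cDiag_of_defType` ∕ `hdef` of ★ `harch_zero_of_defType_tmulG`
for `Ξ = lineCharV_zero … η₀` (★ `archScalar_zeroG_eq_lineCharV`).  Proof: det-rigidity `Ξ = det^k` on `U(V)(L_b)` (§1); at the centre `ζ · 1₃ = (t_ζ · 1₃)_{w b}` (§2) the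
twisted action fixes `linePhi ≠ 0` ((CF₀), §3) while the untwisted one is `det^{a₀ b} = ζ^{3 a₀ b}` (★ `defExponentZero_spec`), so `ζ^{3(k + a₀ b)} = 1` on the circle,
`k = −a₀ b`. [cite: Liu2021, App. D Lem. D.2 (1)] [cite: KonnoKonno2007, Lemma 5.2] -/
theorem hdefT_of_CC :
    ∀ b : {v : InfinitePlace ↥(maximalRealSubfield L) // v.IsReal}, b ≠ HypCensus.cmPlace (L : Type) ι₁ →
      ∀ u : UnitaryGroup.archLocal (L : Type) 3 (Matrix.diagonal (frameD V)) (cmPlaceOver (L : Type) b),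
        ((Ξ (UnitaryGroup.archToAdelic (↥(maximalRealSubfield L)) L (IsCMField.complexConj L) 3 (Matrix.diagonal (frameD V))
            (UnitaryGroup.archSingle (↥(maximalRealSubfield L)) L (IsCMField.complexConj L) 3 (Matrix.diagonal (frameD V))
              (IsCMField.complexConj_ne_one L) (NumberField.complexConj_smul_infinitePlace (L : Type)) (cmPlaceOver (L : Type) b) u)) : ℂˣ) : ℂ) *
          (((u : UnitaryGroup.archLocal (L : Type) 3 (Matrix.diagonal (frameD V)) (cmPlaceOver (L : Type) b)) : GL (Fin 3) ℂ) :
              Matrix (Fin 3) (Fin 3) ℂ).det ^ defExponentZero V c hGR₀ hpos b = 1 := by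
  intro b hb u
  obtain ⟨k, hk⟩ := exists_zpow_archSingle_of_continuous V Ξ hΞc b hb
  -- the exponent read off the centre
  have hk0 : k + defExponentZero V c hGR₀ hpos b = 0 := by
    have h3 : 3 * (k + defExponentZero V c hGR₀ hpos b) = 0 := by
      refine int_eq_zero_of_forall_circle_zpow_eq_one fun ζ => ?_
      -- (CF₀) at the centre concentrated at `w b`
      have hfix := smul_cmArchWeilRep_center_linePhi_of_CC V c hGR₀ hpos Ξ hCC
        ((NumberField.unitaryLineArchTorusContinuousMulEquiv (L : Type)).symm (Pi.mulSingle (cmPlaceOver (L : Type) b).1 ζ))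
      rw [cmArchCenter_equivCircles_symm_mulSingle V b ζ, hk, linePhi_def,
        defExponentZero_spec V c hGR₀ hpos b hb, smul_smul, det_archAt_cmArchCenter_equivCircles_symm_mulSingle V b ζ, ← linePhi_def] at hfix
      have hone := smul_left_injective ℂ (linePhi_ne_zero V (dW c.D 0) (dW_real c.D 0) (dW_ne c.D 0) hpos)
        (hfix.trans (one_smul ℂ _).symm)
      rw [← zpow_mul, ← zpow_mul, ← zpow_add₀ (Circle.coe_ne_zero ζ)] at hone
      rw [← hone]
      congr 1
      ring
    omega
  have hdet : (((u : UnitaryGroup.archLocal (L : Type) 3 (Matrix.diagonal (frameD V)) (cmPlaceOver (L : Type) b)) : GL (Fin 3) ℂ) :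
      Matrix (Fin 3) (Fin 3) ℂ).det ≠ 0 := by
    rw [← Matrix.GeneralLinearGroup.val_det_apply]
    exact Units.ne_zero _
  rw [hk u, ← zpow_add₀ hdet, hk0, zpow_zero]

/-! ## §5 The `v₁`-row from (CC₀) -/

include hemb in
/-- the `ι₁`-section at the central `z · 1 ∈ K`, twisted by any character `χ` of `U(2,1)`, acts on the pinned harmonic vector `linePhi` by the scalar
`χ(z·1) · z^{2 e_P} · z^{e_Q} · z` (★ `smulPull_blockFamilyOfAt_stabilizer` with (K) ★ `cmBlockRepAt_κ_tensorPi_lineVacExponentsZero`; the last `z` is the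
cotangent weight `A(z·1) = z · 1₂` on the degree-one covector). [cite: KonnoKonno2007, Lemma 5.2] -/
theorem smul_cmArchWeilRep_section_centralK_linePhi (χ : U21 →* ℂˣ) (z : unitary ℂ) :
    ((χ (blockU (centralK z)) : ℂˣ) : ℂ) •
        cmArchWeilRep (L : Type) e₁ (frameD V) (frameD_real V) (frameD_ne V) (lineVec (L : Type) (dW c.D 0)) (fun _ => dW_real c.D 0)
          (fun _ => dW_ne c.D 0) hGR₀ (archSectionFrameOf V (blockU (centralK z)), 1) (linePhi V (dW c.D 0) (dW_real c.D 0) (dW_ne c.D 0) hpos) =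
      (((χ (blockU (centralK z)) : ℂˣ) : ℂ) *
          (z : ℂ) ^ (2 * (lineVacExponentsZero V c hGR₀ h₁W (posIdxEquivUnit hpos) (negIdxEquivEmpty hpos)).eP +
            (lineVacExponentsZero V c hGR₀ h₁W (posIdxEquivUnit hpos) (negIdxEquivEmpty hpos)).eQ + 1)) •
        linePhi V (dW c.D 0) (dW_real c.D 0) (dW_ne c.D 0) hpos := by
  have hz : (z : ℂ) ≠ 0 := fun h => by
    have h1 : star (z : ℂ) * z = 1 := Unitary.coe_star_mul_self z
    rw [h, mul_zero] at h1
    exact zero_ne_one h1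
  have hstab := smulPull_blockFamilyOfAt_stabilizer V e₁ (lineVec (L : Type) (dW c.D 0)) (fun _ => dW_real c.D 0) (fun _ => dW_ne c.D 0) hGR₀ χ
    (posIdxEquivUnit hpos) (negIdxEquivEmpty hpos) (degOnePDual Empty) (binvPi 1)
    (hsec_of_embedding_eq V (lineVec (L : Type) (dW c.D 0)) (fun _ => dW_real c.D 0) (fun _ => dW_ne c.D 0) _ _ hemb)
    (fun kk Φ => cmBlockRepAt_κ_tensorPi_lineVacExponentsZero V c hGR₀ h₁W (posIdxEquivUnit hpos) (negIdxEquivEmpty hpos) kk Φ (binvPi 1))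
    (unitaryOpPi_dualPairι_degOnePDual Empty) (blockK (centralK z)) (Pi.single 0 1)
  rw [Representation.smulPull_apply, LinearMap.smul_apply, MonoidHom.prod_apply, MonoidHom.one_apply, coe_blockK, vacScalar_stabilizer,
    ← stabilizerEquivK21_apply, MulEquiv.symm_apply_apply, matA_centralK, sclD_centralK, Matrix.smul_mulVec, Matrix.one_mulVec, map_smul, map_smul, Matrix.det_smul,
    Matrix.det_one, mul_one, Fintype.card_fin, ← linePhi_def, smul_smul] at hstab
  rw [hstab]
  congr 1
  rw [mul_assoc]
  congr 1
  rw [← zpow_natCast, ← zpow_mul, ← zpow_add₀ hz, ← zpow_add_one₀ hz]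
  congr 1

include hΞc hCC hemb in
/-- **THE `v₁`-ROW `hχ₀` FROM (CC₀).**  On `Stab(x₀) = K`, `Ξ((s u)^𝔸) · det A(u)^{e_P} · d(u)^{e_Q} = d̄(u)` for the vacuum exponent tuple of record
`(e_P, e_Q) := lineVacExponentsZero` — the hypothesis `hχ` of ★ `harm_lineOmega_zeroG` for `Ξ = lineCharV_zero … η₀` (★ `lineScalar_zero_eq_lineCharV`), i.e.
`Ξ` has `v₁`-type `−e_P` on the section.  Proof: det-rigidity `Ξ ∘ s = (det A · d)^k` on `K` (§1); at the central `ζ · 1 ∈ K` the section IS the centre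
concentrated at `w(ι₁)` (§2, under `hemb`), whose twisted action fixes `linePhi` ((CF₀), §3) while `smul_cmArchWeilRep_section_centralK_linePhi` computes it as
the scalar `Ξ((s(ζ·1))^𝔸) · ζ^{2 e_P + e_Q + 1}`; so `ζ^{3k + 2e_P + e_Q + 1} = 1` on the circle and, with `e_P − e_Q = 1` (★ `lineVacExponentsZero_eP_sub_eQ`),
`k = −e_P`. [cite: Liu2021, App. D Lem. D.2 (2)] [cite: KonnoKonno2007, Lemma 5.2, Thm. 5.4] -/
theorem hχ_zero_of_CC (u : stabilizer U21 x₀) :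
    ((Ξ (UnitaryGroup.archToAdelic (↥(maximalRealSubfield L)) L (IsCMField.complexConj L) 3 (Matrix.diagonal (frameD V))
        (archSectionFrameOf V (u : U21))) : ℂˣ) : ℂ) *
        ((matA (stabilizerEquivK21.symm u)).det ^ (lineVacExponentsZero V c hGR₀ h₁W (posIdxEquivUnit hpos) (negIdxEquivEmpty hpos)).eP *
          sclD (stabilizerEquivK21.symm u) ^ (lineVacExponentsZero V c hGR₀ h₁W (posIdxEquivUnit hpos) (negIdxEquivEmpty hpos)).eQ) =
      star (sclD (stabilizerEquivK21.symm u)) := by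
  obtain ⟨k, hk⟩ := exists_zpow_section_of_continuous V Ξ hΞc
  have hd := lineVacExponentsZero_eP_sub_eQ V c hGR₀ h₁W (posIdxEquivUnit hpos) (negIdxEquivEmpty hpos)
  -- the exponent read off the centre
  have hk0 : k + (lineVacExponentsZero V c hGR₀ h₁W (posIdxEquivUnit hpos) (negIdxEquivEmpty hpos)).eP = 0 := by
    have h3 : 3 * k + (2 * (lineVacExponentsZero V c hGR₀ h₁W (posIdxEquivUnit hpos) (negIdxEquivEmpty hpos)).eP +
        (lineVacExponentsZero V c hGR₀ h₁W (posIdxEquivUnit hpos) (negIdxEquivEmpty hpos)).eQ + 1) = 0 := by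
      refine int_eq_zero_of_forall_circle_zpow_eq_one fun ζ => ?_
      have hζ : (ζ : ℂ) ≠ 0 := Circle.coe_ne_zero ζ
      -- (CF₀) at the centre concentrated at `w(ι₁)` = the section at `ζ · 1 ∈ K`
      have hfix := smul_cmArchWeilRep_center_linePhi_of_CC V c hGR₀ hpos Ξ hCC
        ((NumberField.unitaryLineArchTorusContinuousMulEquiv (L : Type)).symm (Pi.mulSingle (UnitaryGroup.cmPlace (L : Type) ι₁).1 ζ))
      rw [cmArchCenter_equivCircles_symm_mulSingle_cmPlace V hemb ζ, coe_blockK] at hfix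
      -- the same vector computed by the section formula
      have h2 := smul_cmArchWeilRep_section_centralK_linePhi V c hGR₀ h₁W hpos hemb
        (Ξ.comp ((UnitaryGroup.archToAdelic (↥(maximalRealSubfield L)) L (IsCMField.complexConj L) 3 (Matrix.diagonal (frameD V))).comp
          (archSectionFrameOf V))) (U21Char.circleToUnitary ζ)
      have h2' : ((Ξ (UnitaryGroup.archToAdelic (↥(maximalRealSubfield L)) L (IsCMField.complexConj L) 3 (Matrix.diagonal (frameD V))
            (archSectionFrameOf V (blockU (centralK (U21Char.circleToUnitary ζ))))) : ℂˣ) : ℂ) •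
          cmArchWeilRep (L : Type) e₁ (frameD V) (frameD_real V) (frameD_ne V) (lineVec (L : Type) (dW c.D 0)) (fun _ => dW_real c.D 0)
            (fun _ => dW_ne c.D 0) hGR₀ (archSectionFrameOf V (blockU (centralK (U21Char.circleToUnitary ζ))), 1)
            (linePhi V (dW c.D 0) (dW_real c.D 0) (dW_ne c.D 0) hpos) =
          (((Ξ (UnitaryGroup.archToAdelic (↥(maximalRealSubfield L)) L (IsCMField.complexConj L) 3 (Matrix.diagonal (frameD V))
              (archSectionFrameOf V (blockU (centralK (U21Char.circleToUnitary ζ))))) : ℂˣ) : ℂ) *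
            ((U21Char.circleToUnitary ζ : unitary ℂ) : ℂ) ^ (2 * (lineVacExponentsZero V c hGR₀ h₁W (posIdxEquivUnit hpos) (negIdxEquivEmpty hpos)).eP +
              (lineVacExponentsZero V c hGR₀ h₁W (posIdxEquivUnit hpos) (negIdxEquivEmpty hpos)).eQ + 1)) •
            linePhi V (dW c.D 0) (dW_real c.D 0) (dW_ne c.D 0) hpos := h2
      rw [hfix] at h2'
      have hone := smul_left_injective ℂ (linePhi_ne_zero V (dW c.D 0) (dW_real c.D 0) (dW_ne c.D 0) hpos) (h2'.symm.trans (one_smul ℂ _).symm)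
      rw [hk, matA_centralK, sclD_centralK, Matrix.det_smul, Matrix.det_one, mul_one, Fintype.card_fin, U21Char.coe_circleToUnitary] at hone
      rw [← hone, ← zpow_natCast, ← zpow_add_one₀ hζ, ← zpow_mul, ← zpow_add₀ hζ]
      congr 1
    omega
  -- the row at a general `u ∈ Stab(x₀)`
  have hA : (matA (stabilizerEquivK21.symm u)).det ≠ 0 := (Matrix.UnitaryGroup.det_isUnit (stabilizerEquivK21.symm u).1).ne_zero
  have hdU : sclD (stabilizerEquivK21.symm u) ∈ unitary ℂ := (stabilizerEquivK21.symm u).2.2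
  have hd0 : sclD (stabilizerEquivK21.symm u) ≠ 0 := fun h => by
    have h1 : star (sclD (stabilizerEquivK21.symm u)) * sclD (stabilizerEquivK21.symm u) = 1 := Unitary.coe_star_mul_self (stabilizerEquivK21.symm u).2
    rw [h, mul_zero] at h1
    exact zero_ne_one h1
  have hu : (u : U21) = blockU (stabilizerEquivK21.symm u) := by
    rw [← coe_blockK, ← stabilizerEquivK21_apply, MulEquiv.apply_symm_apply]
  rw [hu, hk, mul_zpow, mul_mul_mul_comm, ← zpow_add₀ hA, ← zpow_add₀ hd0, hk0, zpow_zero, one_mul,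
    star_eq_zpow_neg_one_of_unitary hdU]
  congr 1
  omega

end Rows

/-! ## §6 At the diagonal context `cDiag a`: the `harm` ∕ `hdef` inputs of `distDatumAt` from (CC₀), in the currency of ★ `H413ThetaDistAtLineArchRows` -/

section Continuity

variable {L : CMField} {ι₁ : L →+* ℂ} (V : HermSpace3 L ι₁) (S : StubTree.SeesawDatum L)
variable
  (hGR : (cmSplittingDatum (L : Type) finProdFinEquiv (frameD V) (frameD_real V) (frameD_ne V) (dW S) (dW_real S) (dW_ne S)).CompatibleSplitting)
  (hGR₀ : (cmSplittingDatum (L : Type) (e₁) (frameD V) (frameD_real V) (frameD_ne V) (lineVec (L : Type) (dW S 0))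
    (fun _ => dW_real S 0) (fun _ => dW_ne S 0)).CompatibleSplitting)
  (hGR₁ : (cmSplittingDatum (L : Type) (e₁) (frameD V) (frameD_real V) (frameD_ne V) (lineVec (L : Type) (dW S 1))
    (fun _ => dW_real S 1) (fun _ => dW_ne S 1)).CompatibleSplitting)
  (η : CMAdelic (L : Type) (frameD V) × CMAdelic (L : Type) (dW S) →* ℂˣ) (hηc : Continuous fun p => ((η p : ℂˣ) : ℂ))
  (ν : CMAdelic (L : Type) (frameD V) →* ℂˣ) (hνc : Continuous fun v => ((ν v : ℂˣ) : ℂ))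
  (h₁W : (∀ j, 0 < (ι₁ (dW S j)).re) ∨ ∀ j, (ι₁ (dW S j)).re < 0)

include hηc hνc h₁W in
/-- **the slot-`0` character `Ξ := lineCharV_zero … (etaT₀ η ν)` is continuous** when `η`, `ν` are (the see-saw discrepancy `cmLineChar₀` is continuous from sign
facts, ★ `continuous_cmLineChar₀_of_signs`). [cite: GelbartRogawski1991, §3.1 Remark p. 457 L4–13] -/
theorem continuous_lineCharV_zero_etaT₀ :
    Continuous fun v => ((lineCharV_zero V S hGR hGR₀ hGR₁ (etaT₀ V S η ν) v : ℂˣ) : ℂ) := by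
  have h : (fun v => ((lineCharV_zero V S hGR hGR₀ hGR₁ (etaT₀ V S η ν) v : ℂˣ) : ℂ)) = fun v =>
      ((etaT₀ V S η ν (v, 1) : ℂˣ) : ℂ) *
        ((cmLineChar₀ (L : Type) finProdFinEquiv e₁ (frameD V) (frameD_real V) (frameD_ne V) (dW S) (dW_real S) (dW_ne S) hGR hGR₀ hGR₁ (v, 1) : ℂˣ) : ℂ) := by
    funext v
    rw [lineCharV_zero_apply, Units.val_mul]
  rw [h]
  exact ((continuous_etaT₀ V S η ν hηc hνc).comp (continuous_id.prodMk continuous_const)).mul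
    ((continuous_cmLineChar₀_of_signs (L : Type) finProdFinEquiv e₁ (frameD V) (frameD_real V) (frameD_ne V) (dW S) (dW_real S) (dW_ne S)
      hGR hGR₀ hGR₁ ι₁ (frameD_sign_ι₁' V) h₁W (frameD_sign_of_ne V)).comp (continuous_id.prodMk continuous_const))

end Continuity

section Diag

variable {L : CMField} {ι₁ : L →+* ℂ} (V : HermSpace3 L ι₁)
variable (Φ : CMType (L : Type)) (σ : (L : Type) →+* ℂ) (a : (L : Type)) (ha : IsCMField.complexConj (L : Type) a = a) (ha0 : a ≠ 0)
variable (η : CMAdelic (L : Type) (frameD V) × CMAdelic (L : Type) (dW (cDiag Φ σ a ha ha0).D) →* ℂˣ)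
  (hηc : Continuous fun p => ((η p : ℂˣ) : ℂ))
  (ν : CMAdelic (L : Type) (frameD V) →* ℂˣ)
  (hνc : Continuous fun v => ((ν v : ℂˣ) : ℂ))
  (hV : IsAnisotropic L V.Hm)
  (hpos : 0 < cmXW (L : Type) (frameD V) (lineVec (L : Type) (dW (cDiag Φ σ a ha ha0).D 0)) (fun _ => dW_real (cDiag Φ σ a ha ha0).D 0) ι₁
    (HypCensus.cmPlace (L : Type) ι₁) 0)
  (hemb : (InfinitePlace.mk ι₁).embedding = ι₁)
  -- (CC₀) for the slot-`0` character `Ξ := lineCharV_zero … (etaT₀ η ν)` of the side at the line `a`: `Ξ((t · 1_V)^𝔸) · lineC V a hGR₀ t = 1`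
  (hCC : ∀ t : ↥(Literature.NumberTheory.Automorphic.relNormOneInfUnits (↥(maximalRealSubfield L)) L),
    ((lineCharV_zero V (cDiag Φ σ a ha ha0).D (compat_plane V Φ σ a ha ha0) (compat_line₀ V Φ σ a ha ha0) (compat_line₁ V Φ σ a ha ha0)
          (etaT₀ V (cDiag Φ σ a ha ha0).D η ν) (CMCenter (L : Type) (frameD V) (infUnitToOne (L : Type) t)) : ℂˣ) : ℂ) *
      lineC V a ha ha0 (compat_line₀ V Φ σ a ha ha0) t = 1)

include hηc hνc hemb hCC in
/-- **`harm` AT THE LINE `a` FROM (CC₀).**  For a knob `(η, ν)` whose slot-`0` character `Ξ := lineCharV_zero … (etaT₀ η ν)` satisfies carch's centre identity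
(CC₀) against (F1)'s `lineC V a hGR₀` — i.e. whose twisted slot has central type `−𝟙_{w(ι₁)}` (★ `LiuIndex.centralTypeOfTwist_bigCharOfV_of_CC`) — the slot family
of record satisfies the `harm` law of ★ `ThetaDistAtLine.distDatumAt` (★ `harm_lineOmega_zeroG` with `hχ := hχ_zero_of_CC`).  This replaces the three type rows
`hηm hm hm'` of ★ `harm_cDiag_of_archType` by ONE central identity. [cite: Liu2021, App. D Lem. D.2 (2)] [cite: KonnoKonno2007, Thm 5.4] -/
theorem harm_cDiag_of_CC :
    ∀ (u : ↥(stabilizer U21 x₀)) (ℓ : Module.Dual ℂ (Fin 2 → ℂ)),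
      lineOmega_zero V (cDiag Φ σ a ha ha0).D (compat_plane V Φ σ a ha ha0) (compat_line₀ V Φ σ a ha ha0) (compat_line₁ V Φ σ a ha ha0)
          (etaT₀ V (cDiag Φ σ a ha ha0).D η ν) (u : U21)
          (blockFamilyOfAt (L : Type) e₁ (frameD V) (frameD_real V) (frameD_ne V) (lineVec (L : Type) (dW (cDiag Φ σ a ha ha0).D 0))
            (fun _ => dW_real (cDiag Φ σ a ha ha0).D 0) (fun _ => dW_ne (cDiag Φ σ a ha ha0).D 0) ι₁ (blockPosEquiv V) (blockNegEquiv V)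
            (posIdxEquivUnit hpos) (negIdxEquivEmpty hpos) (degOnePDual Empty) (binvPi 1) ℓ) =
        blockFamilyOfAt (L : Type) e₁ (frameD V) (frameD_real V) (frameD_ne V) (lineVec (L : Type) (dW (cDiag Φ σ a ha ha0).D 0))
          (fun _ => dW_real (cDiag Φ σ a ha ha0).D 0) (fun _ => dW_ne (cDiag Φ σ a ha ha0).D 0) ι₁ (blockPosEquiv V) (blockNegEquiv V)
          (posIdxEquivUnit hpos) (negIdxEquivEmpty hpos) (degOnePDual Empty) (binvPi 1)
          ((BallForms.isPullbackCocycle_cotangentCocycle.weightOf x₀).dual u ℓ) :=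
  harm_lineOmega_zeroG V (cDiag Φ σ a ha ha0) (compat_plane V Φ σ a ha ha0) (compat_line₀ V Φ σ a ha ha0) (compat_line₁ V Φ σ a ha ha0)
    (etaT₀ V (cDiag Φ σ a ha ha0).D η ν) (h₁W_cDiag Φ σ a ha ha0) (binvPi 1) hemb (posIdxEquivUnit hpos) (negIdxEquivEmpty hpos)
    (fun u => hχ_zero_of_CC V (cDiag Φ σ a ha ha0) (compat_line₀ V Φ σ a ha ha0) (h₁W_cDiag Φ σ a ha ha0) hpos hemb
      (lineCharV_zero V (cDiag Φ σ a ha ha0).D (compat_plane V Φ σ a ha ha0) (compat_line₀ V Φ σ a ha ha0) (compat_line₁ V Φ σ a ha ha0)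
        (etaT₀ V (cDiag Φ σ a ha ha0).D η ν))
      (continuous_lineCharV_zero_etaT₀ V (cDiag Φ σ a ha ha0).D (compat_plane V Φ σ a ha ha0) (compat_line₀ V Φ σ a ha ha0)
        (compat_line₁ V Φ σ a ha ha0) η hηc ν hνc (h₁W_cDiag Φ σ a ha ha0)) hCC u)

include hηc hνc hCC in
/-- **`hdef` AT THE LINE `a` FROM (CC₀).**  Under the same central identity the slot family of record satisfies the `hdef` law of `distDatumAt` (★
`harch_zero_of_defType_tmulG` with `hω := defExponentZero_spec` and `hdef := hdefT_of_CC`).  This replaces the definite type row `hdefT` of ★ `hdef_cDiag_of_defType`.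
[cite: Liu2021, App. D Lem. D.2 (1)] -/
theorem hdef_cDiag_of_CC :
    ∀ g : UnitaryGroup.arch (↥(maximalRealSubfield L)) L (IsCMField.complexConj L) 3 V.Hm,
      UnitaryGroup.archAt (↥(maximalRealSubfield L)) L (IsCMField.complexConj L) 3 V.Hm (UnitaryGroup.cmPlace (L : Type) ι₁)
          (NumberField.complexConj_smul_infinitePlace (L : Type) _) (IsCMField.complexConj_ne_one (L : Type)) g = 1 →
      ∀ (ℓ : Module.Dual ℂ (Fin 2 → ℂ)) (Φf : FinSB (↥(maximalRealSubfield L)) (Fin 3)),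
        lineRepOf V (cDiag Φ σ a ha ha0).D (compat_plane V Φ σ a ha ha0) (compat_line₀ V Φ σ a ha ha0) (compat_line₁ V Φ σ a ha ha0)
            (compat_line₂ V Φ σ a ha ha0) (compat_line₃ V Φ σ a ha ha0) (etaT₀ V (cDiag Φ σ a ha ha0).D η ν)
            (etaT₁ V (cDiag Φ σ a ha ha0).D η ν) (eta₂ V (cDiag Φ σ a ha ha0).D η) (eta₃ V (cDiag Φ σ a ha ha0).D η) 0
            (HodgeCM.Adelic.regimeEquiv L V.Hm hV
              (UnitaryGroup.archToAdelic (↥(maximalRealSubfield L)) L (IsCMField.complexConj L) 3 V.Hm g), 1)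
            (piSchwartzBruhatEquiv (↥(maximalRealSubfield L)) (Fin 3)
              (blockFamilyOfAt (L : Type) e₁ (frameD V) (frameD_real V) (frameD_ne V) (lineVec (L : Type) (dW (cDiag Φ σ a ha ha0).D 0))
                (fun _ => dW_real (cDiag Φ σ a ha ha0).D 0) (fun _ => dW_ne (cDiag Φ σ a ha ha0).D 0) ι₁ (blockPosEquiv V) (blockNegEquiv V)
                (posIdxEquivUnit hpos) (negIdxEquivEmpty hpos) (degOnePDual Empty) (binvPi 1) ℓ ⊗ₜ[ℂ] Φf)) =
          piSchwartzBruhatEquiv (↥(maximalRealSubfield L)) (Fin 3)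
            (blockFamilyOfAt (L : Type) e₁ (frameD V) (frameD_real V) (frameD_ne V) (lineVec (L : Type) (dW (cDiag Φ σ a ha ha0).D 0))
                (fun _ => dW_real (cDiag Φ σ a ha ha0).D 0) (fun _ => dW_ne (cDiag Φ σ a ha ha0).D 0) ι₁ (blockPosEquiv V) (blockNegEquiv V)
                (posIdxEquivUnit hpos) (negIdxEquivEmpty hpos) (degOnePDual Empty) (binvPi 1) ℓ ⊗ₜ[ℂ] Φf) :=
  harch_zero_of_defType_tmulG V (cDiag Φ σ a ha ha0).D (compat_plane V Φ σ a ha ha0) (compat_line₀ V Φ σ a ha ha0) (compat_line₁ V Φ σ a ha ha0)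
    (compat_line₂ V Φ σ a ha ha0) (compat_line₃ V Φ σ a ha ha0) (etaT₀ V (cDiag Φ σ a ha ha0).D η ν) (etaT₁ V (cDiag Φ σ a ha ha0).D η ν)
    (eta₂ V (cDiag Φ σ a ha ha0).D η) (eta₃ V (cDiag Φ σ a ha ha0).D η) hV (posIdxEquivUnit hpos) (negIdxEquivEmpty hpos)
    (defExponentZero V (cDiag Φ σ a ha ha0) (compat_line₀ V Φ σ a ha ha0) hpos)
    (defExponentZero_spec V (cDiag Φ σ a ha ha0) (compat_line₀ V Φ σ a ha ha0) hpos)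
    (hdefT_of_CC V (cDiag Φ σ a ha ha0) (compat_line₀ V Φ σ a ha ha0) hpos
      (lineCharV_zero V (cDiag Φ σ a ha ha0).D (compat_plane V Φ σ a ha ha0) (compat_line₀ V Φ σ a ha ha0) (compat_line₁ V Φ σ a ha ha0)
        (etaT₀ V (cDiag Φ σ a ha ha0).D η ν))
      (continuous_lineCharV_zero_etaT₀ V (cDiag Φ σ a ha ha0).D (compat_plane V Φ σ a ha ha0) (compat_line₀ V Φ σ a ha ha0)
        (compat_line₁ V Φ σ a ha ha0) η hηc ν hνc (h₁W_cDiag Φ σ a ha ha0)) hCC)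

end Diag

end Summit.HodgeConjecture.HodgeConjecture.Cruxes.H413.ThetaDistAtLine

end
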